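import Literature.AnabelianGeometry.SemiGraphs.WitnessIwahoriCoherent
import Literature.AnabelianGeometry.SemiGraphs.WitnessIwahoriCusp
import Literature.AnabelianGeometry.SemiGraphs.WitnessIwahoriDouble
import Literature.AnabelianGeometry.SemiGraphs.UniversalCoveringCor39
import HarnessLib

/-!
# [SemiAnbd] Cor 3.9 (up to twist) AT the universal graph-covering of the estranged loop — literal
# instances; coherence of the whole Iwahori witness family

S. Mochizuki, *Semi-graphs of anabelioids*, Publ. RIMS **42** (2006), Def. 2.3 (iii) p. 25 (coherent),
Cor. 3.9 pp. 42–43 [cite: MochizukiSemiAnbd2006, Cor 3.9 pp.42-43]; [IUTchI] Rmk. 2.5.3 (i) (T3) p. 53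
(finite and coherent ⇒ strictly coherent).

PROOF-ONLY file (cell abc-iut, layer L3; seat abc-iut-w6-d120, sequel of `WitnessIwahoriCoherent`; no
definition, no new named fact).  Two things, both BY NAME:

1. COHERENCE OF THE IWAHORI WITNESS FAMILY.  The cusp witness `cuspGraph p` (abc-iut-f-177: one vertex
   `P = ℤ_p ⋊ (1 + pℤ_p)`, one OPEN edge `U = 1 + pℤ_p` along the torus) and the segment `doubleLoop p`
   (abc-iut-f-175: the double of the estranged loop along its torus branch) have the same constituent groups
   `Iw p`, `IwU p` as the loop, so the topological finite generation theorems
   `Iw.exists_finset_topologicalClosure_eq_top` / `IwU.exists_finset_topologicalClosure_eq_top` make them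
   coherent and (being finite) strictly coherent: `cuspGraph_isCoherent`, `cuspGraph_isStrictlyCoherent`,
   `doubleLoop_isCoherent`, `doubleLoop_isStrictlyCoherent`.
2. COR 3.9 AT THE IWAHORI CHAIN.  With `loopGraph_cor39Hypotheses` (abc-iut-w5-d236) and
   `loopGraph_isCoherent`, abc-iut-L3-d1's `UniversalCoveringCor39` (p458056) fires LITERALLY at the estranged
   loop `𝒢₁ = loopGraph p`: the hypotheses of Cor. 3.9 hold at the universal graph-covering `𝒢₁,∞`
   (`cor39Hypotheses_univCover_loopGraph`); Cor. 3.9 (a)+(b)+uniqueness UP TO TWIST holds at every pair of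
   Iwahori chains `𝒢₁(p)_∞ ↔ 𝒢₁(q)_∞`, any primes, any base orbits, any charts — the [EtTh] §1 shape
   `Y ↔ Y′` (`cor39UpToTwistAt_univCover_loopGraph`, `cor39CompatUpToTwistAt_univCover_loopGraph`) — and at
   the pair (chain, base) `𝒢₁,∞ → 𝒢₁`, the shape `Y → X` (`cor39UpToTwistAt_univCover_base_loopGraph`);
   packaged non-vacuity of p458056's class «finite coherent Cor-3.9 GRAPH with an edge»:
   `exists_finite_coherent_cor39_graph_univCover`.  Beside it, the segment: `cor39Hypotheses_univCover_doubleLoop`.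
3. PROP 3.6 (v) AT THE FAMILY.  Strict coherence discharges the «uniform splitting» clause of the proof of
   Prop. 3.6 (v) (`uniformSplittingAt_of_isStrictlyCoherent`), so `B^temp(𝒢_S) ≌ B^temp(𝒢)_S` holds for
   every tempered `S` over each of the three witnesses, hypothesis-free (`uniformSplittingAt_loopGraph`,
   `nonempty_etaleEquiv_loopGraph`, `…_cuspGraph`, `…_doubleLoop`). [cite: MochizukiSemiAnbd2006, Prop 3.6(v) p.39]

Nothing here concerns the disputed corpus; no side is taken on [IUTchIII] Cor. 3.12; typed ≠ proved.
-/

noncomputable section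

namespace Literature.AnabelianGeometry.SemiGraphs

namespace IwahoriWitness

open CategoryTheory ProfiniteSemiGraph

variable (p : ℕ) [Fact p.Prime]

/-! ## 1. The cusp witness and the doubled loop are coherent -/

/-- `cuspGraph p`'s underlying semi-graph (one vertex, one open edge) is finite. [cite: MochizukiSemiAnbd2006, §1 p.11] -/
theorem cuspGraph_isFinite : (cuspGraph p).graph.IsFinite :=
  ⟨inferInstanceAs (Finite PUnit), inferInstanceAs (Finite PUnit)⟩

/-- **The cusp witness is coherent** (Def. 2.3 (iii)): quasi-coherent (`cuspGraph_isQuasiCoherent`) with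
topologically finitely generated `P` and `U`. [cite: MochizukiSemiAnbd2006, Def 2.3(iii) p.25] -/
theorem cuspGraph_isCoherent : (cuspGraph p).IsCoherent := by
  refine ⟨cuspGraph_isQuasiCoherent p, fun _ => ?_, fun _ => ?_⟩
  · obtain ⟨s, -, hs⟩ := Iw.exists_finset_topologicalClosure_eq_top (p := p)
    exact ⟨s, hs⟩
  · obtain ⟨s, -, hs⟩ := IwU.exists_finset_topologicalClosure_eq_top (p := p)
    exact ⟨s, hs⟩

/-- The cusp witness is strictly coherent ([IUTchI] Rmk. 2.5.3 (i) (T3)).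
[cite: Mochizuki2012, IUTchI Rem. 2.5.3(i)(T3) p.53] -/
theorem cuspGraph_isStrictlyCoherent : (cuspGraph p).IsStrictlyCoherent :=
  isStrictlyCoherent_of_finite (cuspGraph_isFinite p) (cuspGraph_isCoherent p)

/-- `doubleLoop p`'s underlying semi-graph (a segment) is finite. [cite: MochizukiSemiAnbd2006, §1 p.11] -/
theorem doubleLoop_isFinite : (doubleLoop p).graph.IsFinite :=
  ⟨inferInstanceAs (Finite (ULift Bool)), inferInstanceAs (Finite PUnit)⟩

/-- **The doubled loop (segment `v₀ —— v₁`, `Π_v = P`, `Π_e = U`) is coherent** (Def. 2.3 (iii)).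
[cite: MochizukiSemiAnbd2006, Def 2.3(iii) p.25] -/
theorem doubleLoop_isCoherent : (doubleLoop p).IsCoherent := by
  refine ⟨doubleLoop_isQuasiCoherent p, fun _ => ?_, fun _ => ?_⟩
  · obtain ⟨s, -, hs⟩ := Iw.exists_finset_topologicalClosure_eq_top (p := p)
    exact ⟨s, hs⟩
  · obtain ⟨s, -, hs⟩ := IwU.exists_finset_topologicalClosure_eq_top (p := p)
    exact ⟨s, hs⟩

/-- The doubled loop is strictly coherent ([IUTchI] Rmk. 2.5.3 (i) (T3)).
[cite: Mochizuki2012, IUTchI Rem. 2.5.3(i)(T3) p.53] -/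
theorem doubleLoop_isStrictlyCoherent : (doubleLoop p).IsStrictlyCoherent :=
  isStrictlyCoherent_of_finite (doubleLoop_isFinite p) (doubleLoop_isCoherent p)

/-! ## 2. Cor 3.9 AT the universal graph-covering `𝒢₁,∞` of the estranged loop -/

/-- **The hypotheses of [SemiAnbd] Cor. 3.9 hold AT `𝒢₁,∞`**, the covering semi-graph of anabelioids of the
universal graph-covering of the estranged loop (every base vertex-orbit), hypothesis-free.
[cite: MochizukiSemiAnbd2006, Cor 3.9 p.42] -/
theorem cor39Hypotheses_univCover_loopGraph
    (V₀ : (CovObj.trivialCov (loopGraph p) PUnit.{1}).OVertex) :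
    Cor39Hypotheses ((CovObj.trivialCov (loopGraph p) PUnit.{1}).univCoverOver (Sum.inl V₀)
      (loopGraph_thm37Hypotheses p).isCountable).coveringGraph := by
  haveI : Finite (loopGraph p).graph.Vertex := (loopGraph_isFinite p).finite_vertex
  haveI : Finite (loopGraph p).graph.Edge := (loopGraph_isFinite p).finite_edge
  exact cor39Hypotheses_univCover (loopGraph_cor39Hypotheses p) (loopGraph_isCoherent p) V₀ _

/-- The hypotheses of Cor. 3.9 hold at `𝒢₁,∞,F` for every FINITE covering object `F` of `𝒢₁`.
[cite: MochizukiSemiAnbd2006, Cor 3.9 p.42] -/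
theorem cor39Hypotheses_univCoverOver_loopGraph (F : CovObj (loopGraph p)) (hF : F.IsFinite)
    (V₀ : F.OVertex) :
    Cor39Hypotheses (F.univCoverOver (Sum.inl V₀) (loopGraph_thm37Hypotheses p).isCountable).coveringGraph := by
  haveI : Finite (loopGraph p).graph.Vertex := (loopGraph_isFinite p).finite_vertex
  haveI : Finite (loopGraph p).graph.Edge := (loopGraph_isFinite p).finite_edge
  exact F.cor39Hypotheses_univCoverOver (loopGraph_cor39Hypotheses p) (loopGraph_isCoherent p) hF V₀ _

/-- **[SemiAnbd] Cor. 3.9, up to twist, AT THE PAIR OF IWAHORI CHAINS `𝒢₁(p)_∞ ↔ 𝒢₁(q)_∞`** (any primes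
`p`, `q`, any base vertex-orbits, any charts; the [EtTh] §1 shape `Y ↔ Y′`), hypothesis-free: (a) a
homomorphism induced up to twist by a locally open morphism is compatibly quasi-geometric; (b) every
compatibly quasi-geometric homomorphism is so induced, uniquely on underlying semi-graphs.
[cite: MochizukiSemiAnbd2006, Cor 3.9 pp.42-43] -/
theorem cor39UpToTwistAt_univCover_loopGraph (q : ℕ) [Fact q.Prime]
    (V₀ : (CovObj.trivialCov (loopGraph p) PUnit.{1}).OVertex)
    (W₀ : (CovObj.trivialCov (loopGraph q) PUnit.{1}).OVertex)
    (c : TemperedPiChart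
      ((CovObj.trivialCov (loopGraph p) PUnit.{1}).univCoverOver (Sum.inl V₀)
        (loopGraph_thm37Hypotheses p).isCountable).coveringGraph)
    (c' : TemperedPiChart
      ((CovObj.trivialCov (loopGraph q) PUnit.{1}).univCoverOver (Sum.inl W₀)
        (loopGraph_thm37Hypotheses q).isCountable).coveringGraph) :
    (∀ (Φ : Hom ((CovObj.trivialCov (loopGraph p) PUnit.{1}).univCoverOver (Sum.inl V₀)
          (loopGraph_thm37Hypotheses p).isCountable).coveringGraph
        ((CovObj.trivialCov (loopGraph q) PUnit.{1}).univCoverOver (Sum.inl W₀)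
          (loopGraph_thm37Hypotheses q).isCountable).coveringGraph),
        Φ.IsLocallyOpen → ∀ φ : c.G →ₜ* c'.G,
          (∃ θ : Φ.ConjugatorFamily, Nonempty (Φ.chartPullbackWith θ c c' ≅ BTemp.res φ)) →
            IsCompatiblyQuasiGeometric φ) ∧
      ∀ φ : c.G →ₜ* c'.G, IsCompatiblyQuasiGeometric φ →
        ∃ Φ : Hom ((CovObj.trivialCov (loopGraph p) PUnit.{1}).univCoverOver (Sum.inl V₀)
              (loopGraph_thm37Hypotheses p).isCountable).coveringGraph
            ((CovObj.trivialCov (loopGraph q) PUnit.{1}).univCoverOver (Sum.inl W₀)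
              (loopGraph_thm37Hypotheses q).isCountable).coveringGraph,
          Φ.IsLocallyOpen ∧
          (∃ θ : Φ.ConjugatorFamily, Nonempty (Φ.chartPullbackWith θ c c' ≅ BTemp.res φ)) ∧
          ∀ Φ' : Hom
              ((CovObj.trivialCov (loopGraph p) PUnit.{1}).univCoverOver (Sum.inl V₀)
                (loopGraph_thm37Hypotheses p).isCountable).coveringGraph
              ((CovObj.trivialCov (loopGraph q) PUnit.{1}).univCoverOver (Sum.inl W₀)
                (loopGraph_thm37Hypotheses q).isCountable).coveringGraph,
            Φ'.IsLocallyOpen →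
            (∃ θ' : Φ'.ConjugatorFamily, Nonempty (Φ'.chartPullbackWith θ' c c' ≅ BTemp.res φ)) →
              Φ'.base.vertexMap = Φ.base.vertexMap ∧ Φ'.base.edgeMap = Φ.base.edgeMap := by
  haveI : Finite (loopGraph p).graph.Vertex := (loopGraph_isFinite p).finite_vertex
  haveI : Finite (loopGraph p).graph.Edge := (loopGraph_isFinite p).finite_edge
  haveI : Finite (loopGraph q).graph.Vertex := (loopGraph_isFinite q).finite_vertex
  haveI : Finite (loopGraph q).graph.Edge := (loopGraph_isFinite q).finite_edge
  exact cor39UpToTwistAt_univCover (loopGraph_cor39Hypotheses p) (loopGraph_isCoherent p)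
    (loopGraph_cor39Hypotheses q) (loopGraph_isCoherent q) V₀ W₀ _ _ c c'

/-- **Cor. 3.9 at the pair of Iwahori chains, `InducesUpToTwist` currency** (the body of
`Cor39CompatUpToTwist`, hypothesis-free). [cite: MochizukiSemiAnbd2006, Cor 3.9 pp.42-43] -/
theorem cor39CompatUpToTwistAt_univCover_loopGraph (q : ℕ) [Fact q.Prime]
    (V₀ : (CovObj.trivialCov (loopGraph p) PUnit.{1}).OVertex)
    (W₀ : (CovObj.trivialCov (loopGraph q) PUnit.{1}).OVertex)
    (c : TemperedPiChart
      ((CovObj.trivialCov (loopGraph p) PUnit.{1}).univCoverOver (Sum.inl V₀)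
        (loopGraph_thm37Hypotheses p).isCountable).coveringGraph)
    (c' : TemperedPiChart
      ((CovObj.trivialCov (loopGraph q) PUnit.{1}).univCoverOver (Sum.inl W₀)
        (loopGraph_thm37Hypotheses q).isCountable).coveringGraph) :
    (∀ (Φ : Hom ((CovObj.trivialCov (loopGraph p) PUnit.{1}).univCoverOver (Sum.inl V₀)
          (loopGraph_thm37Hypotheses p).isCountable).coveringGraph
        ((CovObj.trivialCov (loopGraph q) PUnit.{1}).univCoverOver (Sum.inl W₀)
          (loopGraph_thm37Hypotheses q).isCountable).coveringGraph),
        Φ.IsLocallyOpen → ∀ φ : c.G →ₜ* c'.G, Φ.InducesUpToTwist c c' φ →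
          IsCompatiblyQuasiGeometric φ) ∧
      ∀ φ : c.G →ₜ* c'.G, IsCompatiblyQuasiGeometric φ →
        ∃ Φ : Hom ((CovObj.trivialCov (loopGraph p) PUnit.{1}).univCoverOver (Sum.inl V₀)
              (loopGraph_thm37Hypotheses p).isCountable).coveringGraph
            ((CovObj.trivialCov (loopGraph q) PUnit.{1}).univCoverOver (Sum.inl W₀)
              (loopGraph_thm37Hypotheses q).isCountable).coveringGraph,
          Φ.IsLocallyOpen ∧ Φ.InducesUpToTwist c c' φ ∧
          ∀ Φ' : Hom
              ((CovObj.trivialCov (loopGraph p) PUnit.{1}).univCoverOver (Sum.inl V₀)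
                (loopGraph_thm37Hypotheses p).isCountable).coveringGraph
              ((CovObj.trivialCov (loopGraph q) PUnit.{1}).univCoverOver (Sum.inl W₀)
                (loopGraph_thm37Hypotheses q).isCountable).coveringGraph,
            Φ'.IsLocallyOpen → Φ'.InducesUpToTwist c c' φ → Φ'.base = Φ.base := by
  haveI : Finite (loopGraph p).graph.Vertex := (loopGraph_isFinite p).finite_vertex
  haveI : Finite (loopGraph p).graph.Edge := (loopGraph_isFinite p).finite_edge
  haveI : Finite (loopGraph q).graph.Vertex := (loopGraph_isFinite q).finite_vertex
  haveI : Finite (loopGraph q).graph.Edge := (loopGraph_isFinite q).finite_edge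
  exact cor39CompatUpToTwistAt_univCover (loopGraph_cor39Hypotheses p) (loopGraph_isCoherent p)
    (loopGraph_cor39Hypotheses q) (loopGraph_isCoherent q) V₀ W₀ _ _ c c'

/-- **Cor. 3.9, up to twist, at the pair `(𝒢₁,∞, 𝒢₁)`** — the Iwahori chain against its own base, the
[EtTh] §1 shape `Y → X`; every pair of charts, hypothesis-free. [cite: MochizukiSemiAnbd2006, Cor 3.9 pp.42-43] -/
theorem cor39UpToTwistAt_univCover_base_loopGraph
    (V₀ : (CovObj.trivialCov (loopGraph p) PUnit.{1}).OVertex)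
    (c : TemperedPiChart
      ((CovObj.trivialCov (loopGraph p) PUnit.{1}).univCoverOver (Sum.inl V₀)
        (loopGraph_thm37Hypotheses p).isCountable).coveringGraph)
    (c𝒢 : TemperedPiChart (loopGraph p)) :
    (∀ (Φ : Hom ((CovObj.trivialCov (loopGraph p) PUnit.{1}).univCoverOver (Sum.inl V₀)
          (loopGraph_thm37Hypotheses p).isCountable).coveringGraph (loopGraph p)),
        Φ.IsLocallyOpen → ∀ φ : c.G →ₜ* c𝒢.G,
          (∃ θ : Φ.ConjugatorFamily, Nonempty (Φ.chartPullbackWith θ c c𝒢 ≅ BTemp.res φ)) →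
            IsCompatiblyQuasiGeometric φ) ∧
      ∀ φ : c.G →ₜ* c𝒢.G, IsCompatiblyQuasiGeometric φ →
        ∃ Φ : Hom ((CovObj.trivialCov (loopGraph p) PUnit.{1}).univCoverOver (Sum.inl V₀)
              (loopGraph_thm37Hypotheses p).isCountable).coveringGraph (loopGraph p),
          Φ.IsLocallyOpen ∧
          (∃ θ : Φ.ConjugatorFamily, Nonempty (Φ.chartPullbackWith θ c c𝒢 ≅ BTemp.res φ)) ∧
          ∀ Φ' : Hom
              ((CovObj.trivialCov (loopGraph p) PUnit.{1}).univCoverOver (Sum.inl V₀)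
                (loopGraph_thm37Hypotheses p).isCountable).coveringGraph (loopGraph p),
            Φ'.IsLocallyOpen →
            (∃ θ' : Φ'.ConjugatorFamily, Nonempty (Φ'.chartPullbackWith θ' c c𝒢 ≅ BTemp.res φ)) →
              Φ'.base.vertexMap = Φ.base.vertexMap ∧ Φ'.base.edgeMap = Φ.base.edgeMap := by
  haveI : Finite (loopGraph p).graph.Vertex := (loopGraph_isFinite p).finite_vertex
  haveI : Finite (loopGraph p).graph.Edge := (loopGraph_isFinite p).finite_edge
  exact cor39UpToTwistAt_univCover_base (loopGraph_cor39Hypotheses p) (loopGraph_isCoherent p) V₀ _ c c𝒢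

/-- NON-VACUITY OF THE CLASS «finite coherent Cor-3.9 graph (every branch abuts) with an edge» at which
p458056 is stated, together with the Cor-3.9 hypotheses and both Thm-3.7 At-forms at its universal
graph-covering: witnessed by the estranged loop (at `p = 2`, say). [cite: MochizukiSemiAnbd2006, Cor 3.9 pp.42-43] -/
theorem exists_finite_coherent_cor39_graph_univCover :
    ∃ (𝒢 : ProfiniteSemiGraph.{0}) (h39 : Cor39Hypotheses 𝒢), 𝒢.IsStrictlyCoherent ∧ 𝒢.graph.IsFinite ∧
      Nonempty 𝒢.graph.Edge ∧ Nonempty (CovObj.trivialCov 𝒢 PUnit.{1}).OVertex ∧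
      ∀ V₀ : (CovObj.trivialCov 𝒢 PUnit.{1}).OVertex,
        Cor39Hypotheses
            ((CovObj.trivialCov 𝒢 PUnit.{1}).univCoverOver (Sum.inl V₀) h39.isCountable).coveringGraph ∧
          CompactInVerticialAt
            ((CovObj.trivialCov 𝒢 PUnit.{1}).univCoverOver (Sum.inl V₀) h39.isCountable).coveringGraph ∧
          MaximalCompactIffVerticialAt
            ((CovObj.trivialCov 𝒢 PUnit.{1}).univCoverOver (Sum.inl V₀) h39.isCountable).coveringGraph :=
  haveI : Fact (Nat.Prime 2) := ⟨Nat.prime_two⟩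
  ⟨loopGraph 2, loopGraph_cor39Hypotheses 2, loopGraph_isStrictlyCoherent 2, loopGraph_isFinite 2,
    ⟨ULift.up (0 : Fin 1)⟩, nonempty_oVertex_trivialCov_loopGraph 2, fun V₀ =>
      ⟨cor39Hypotheses_univCover_loopGraph 2 V₀, compactInVerticialAt_univCover_loopGraph 2 V₀,
        maximalCompactIffVerticialAt_univCover_loopGraph 2 V₀⟩⟩

/-! ## 3. The segment `doubleLoop p`: Cor 3.9 hypotheses at its (trivial) universal graph-covering -/

/-- The doubled loop has a vertex-orbit in its one-sheeted trivial covering. [cite: MochizukiSemiAnbd2006, Def 3.5(i) p.37] -/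
theorem nonempty_oVertex_trivialCov_doubleLoop :
    Nonempty (CovObj.trivialCov (doubleLoop p) PUnit.{1}).OVertex :=
  nonempty_oVertex_trivialCov_punit (doubleLoop_hasVertex p)

/-- The hypotheses of Cor. 3.9 hold at the universal graph-covering of the segment `doubleLoop p` (a tree,
so the covering is one-sheeted; recorded for uniformity of the witness family).
[cite: MochizukiSemiAnbd2006, Cor 3.9 p.42] -/
theorem cor39Hypotheses_univCover_doubleLoop
    (V₀ : (CovObj.trivialCov (doubleLoop p) PUnit.{1}).OVertex) :
    Cor39Hypotheses ((CovObj.trivialCov (doubleLoop p) PUnit.{1}).univCoverOver (Sum.inl V₀)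
      (doubleLoop_thm37Hypotheses p).isCountable).coveringGraph := by
  haveI : Finite (doubleLoop p).graph.Vertex := (doubleLoop_isFinite p).finite_vertex
  haveI : Finite (doubleLoop p).graph.Edge := (doubleLoop_isFinite p).finite_edge
  exact cor39Hypotheses_univCover (doubleLoop_cor39Hypotheses p) (doubleLoop_isCoherent p) V₀ _

/-- Thm 3.7 (iii)/(iv) At-forms at the universal graph-covering of the segment `doubleLoop p`.
[cite: MochizukiSemiAnbd2006, Thm 3.7(iii)(iv) pp.40-41] -/
theorem compactInVerticialAt_univCover_doubleLoop
    (V₀ : (CovObj.trivialCov (doubleLoop p) PUnit.{1}).OVertex) :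
    CompactInVerticialAt ((CovObj.trivialCov (doubleLoop p) PUnit.{1}).univCoverOver (Sum.inl V₀)
        (doubleLoop_thm37Hypotheses p).isCountable).coveringGraph ∧
      MaximalCompactIffVerticialAt ((CovObj.trivialCov (doubleLoop p) PUnit.{1}).univCoverOver
        (Sum.inl V₀) (doubleLoop_thm37Hypotheses p).isCountable).coveringGraph := by
  haveI : Finite (doubleLoop p).graph.Vertex := (doubleLoop_isFinite p).finite_vertex
  haveI : Finite (doubleLoop p).graph.Edge := (doubleLoop_isFinite p).finite_edge
  exact ⟨compactInVerticialAt_univCover (doubleLoop_thm37Hypotheses p) (doubleLoop_isCoherent p) V₀,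
    maximalCompactIffVerticialAt_univCover (doubleLoop_thm37Hypotheses p) (doubleLoop_isCoherent p) V₀⟩

/-! ## 4. Prop 3.6 (v) — uniform splitting and `B^temp(𝒢_S) ≌ B^temp(𝒢)_S` — at the Iwahori witnesses -/

/-- **[SemiAnbd] Prop. 3.6 (v) «uniform splitting» at every tempered object `S` of the estranged loop**,
hypothesis-free (the strictly coherent case `uniformSplittingAt_of_isStrictlyCoherent`, [IUTchI] Rmk. 2.5.3
(i) (T4)). [cite: MochizukiSemiAnbd2006, Prop 3.6(v) p.40] -/
theorem uniformSplittingAt_loopGraph (S : CovObj (loopGraph p)) (hS : S.IsTempered) :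
    S.UniformSplittingAt :=
  S.uniformSplittingAt_of_isStrictlyCoherent (loopGraph_prop36Hypotheses p) (loopGraph_isStrictlyCoherent p) hS

/-- **[SemiAnbd] Prop. 3.6 (v) at the estranged loop**: `B^temp((𝒢₁)_S) ≌ B^temp(𝒢₁)_S` for every tempered
`S`, hypothesis-free. [cite: MochizukiSemiAnbd2006, Prop 3.6(v) p.39] -/
theorem nonempty_etaleEquiv_loopGraph (S : CovObj (loopGraph p)) (hS : S.IsTempered) :
    Nonempty (BTempCat S.coveringGraph ≌ Over (⟨S, hS⟩ : BTempCat (loopGraph p))) :=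
  ⟨S.etaleEquivOfAt (uniformSplittingAt_loopGraph p S hS) hS⟩

/-- Prop. 3.6 (v) «uniform splitting» at every tempered object of the cusp witness.
[cite: MochizukiSemiAnbd2006, Prop 3.6(v) p.40] -/
theorem uniformSplittingAt_cuspGraph (S : CovObj (cuspGraph p)) (hS : S.IsTempered) :
    S.UniformSplittingAt :=
  S.uniformSplittingAt_of_isStrictlyCoherent (cuspGraph_prop36Hypotheses p) (cuspGraph_isStrictlyCoherent p) hS

/-- Prop. 3.6 (v) at the cusp witness: `B^temp(𝒢_S) ≌ B^temp(𝒢)_S`. [cite: MochizukiSemiAnbd2006, Prop 3.6(v) p.39] -/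
theorem nonempty_etaleEquiv_cuspGraph (S : CovObj (cuspGraph p)) (hS : S.IsTempered) :
    Nonempty (BTempCat S.coveringGraph ≌ Over (⟨S, hS⟩ : BTempCat (cuspGraph p))) :=
  ⟨S.etaleEquivOfAt (uniformSplittingAt_cuspGraph p S hS) hS⟩

/-- Prop. 3.6 (v) «uniform splitting» at every tempered object of the doubled loop.
[cite: MochizukiSemiAnbd2006, Prop 3.6(v) p.40] -/
theorem uniformSplittingAt_doubleLoop (S : CovObj (doubleLoop p)) (hS : S.IsTempered) :
    S.UniformSplittingAt :=
  S.uniformSplittingAt_of_isStrictlyCoherent (doubleLoop_prop36Hypotheses p)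
    (doubleLoop_isStrictlyCoherent p) hS

/-- Prop. 3.6 (v) at the doubled loop: `B^temp(𝒢_S) ≌ B^temp(𝒢)_S`. [cite: MochizukiSemiAnbd2006, Prop 3.6(v) p.39] -/
theorem nonempty_etaleEquiv_doubleLoop (S : CovObj (doubleLoop p)) (hS : S.IsTempered) :
    Nonempty (BTempCat S.coveringGraph ≌ Over (⟨S, hS⟩ : BTempCat (doubleLoop p))) :=
  ⟨S.etaleEquivOfAt (uniformSplittingAt_doubleLoop p S hS) hS⟩

end IwahoriWitness

end Literature.AnabelianGeometry.SemiGraphs
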